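import Summits.BirchSwinnertonDyer.BirchSwinnertonDyer.Theorems.PrintX9HowardContainmentOfKolyvaginSystemLeaf
import HarnessLib

/-!
# Line `torsion-depth-light-ofprint` on crux `HowardContainmentLightFrameOfPrint` (stmt-BirchSwinnertonDyer-25235),
# RESHAPED CUT v5 — ONE STUB = A `closes`-BINDER (x9-p1 LEAD g7, 2026-08-29)

The crux (route PrintX9; aside r203) is
`MastellaZermanHowardDivisibility → CGLSHowardDivisibilityLocalized → AnticyclotomicTowerInRingClassFields →
HowardContainmentLightFrame`. Census of record (LEAD g5 #13; x9-p2 g8; ref g7; LEAD g7): AS TYPED it is not closable by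
name — at `p ∣ h_K` the untied containment needs a non-torsion `Λ`-adic Heegner class (Cornut–Vatsal), which none of its
three binders supplies. Cut v4 (x9-p2 g9) took that input from the EXTRA cite-only leaf `CGLSHeegnerClassNonvanishing`
(stmt-27103). Cut v5 takes it instead from a leaf the route ALREADY carries as a binder of `PrintX9.closes`:
`CGLSHeegnerKolyvaginSystem` (= `CastellaGrossiLeeSkinner2022.thm411_exists_kolyvaginSystem_one_ne_zero`, F-411, CGLS 2022
Thm. 4.1.1 in Kolyvagin-system form with Rem. 4.1.4), via the LANDED chain of this seat:
`HeegnerStabilizedOfKSLeaf.stabilizedClass_ne_zero_of_kolyvaginSystemLeaf` (F-411 ⟹ `κ_∞ ≠ 0` at the engine's coherent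
datum; p689159) and `PrintX9OfKolyvaginSystemLeaf.howardContainmentLightFrameOfPrint_of_kolyvaginSystemLeaf :
CGLSHeegnerKolyvaginSystem → HowardContainmentLightFrameOfPrint`.
Reading of the registry after this check: «25235 closes modulo exactly the `closes`-binder F-411» — i.e. the aside adds
NOTHING to the route's trust base beyond what `closes` already assumes. Composition concludes the crux BY NAME; `sorry`
only inside `stub_*`. No summit statement is proved; BSD is NOT proved by any of this.
-/

set_option linter.dupNamespace false
set_option autoImplicit false

namespace Summit.BirchSwinnertonDyer.BirchSwinnertonDyer.Cruxes.HowardContainmentLightFrameOfPrint.TorsionDepthLight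

/-! ## Stub statement as a named proposition -/

/-- **The one stub of cut v5: CGLS 2022 Thm. 4.1.1 in Kolyvagin-system form (F-411) BY NAME** — the route's cite-only
print leaf `CGLSHeegnerKolyvaginSystem` (a binder `hK` of `PrintX9.closes`) VERBATIM. It closes only when the leaf
becomes a kernel theorem. [cite: CastellaGrossiLeeSkinner2022, Thm. 4.1.1, Rem. 4.1.4 (arXiv:2008.02571 §4.1)] -/
def Stmt.stub_cglsHeegnerKolyvaginSystem : Prop :=
  Summit.BirchSwinnertonDyer.BirchSwinnertonDyer.Theses.PrintX9.CGLSHeegnerKolyvaginSystem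

/-! ## The stub (the ONLY sorry of the file) -/

/-- Stub: the print leaf `CGLSHeegnerKolyvaginSystem` (F-411, a `closes` binder), cite-only. -/
theorem stub_cglsHeegnerKolyvaginSystem : Stmt.stub_cglsHeegnerKolyvaginSystem := by
  sorry

/-! ## Composition (kernel-checked, no `sorry`) -/

/-- **The crux BY NAME from the one stub**: the landed closer
`PrintX9OfKolyvaginSystemLeaf.howardContainmentLightFrameOfPrint_of_kolyvaginSystemLeaf` applied to the stub letter
(which unfolds to the leaf `CGLSHeegnerKolyvaginSystem` by `rfl`). -/
theorem HowardContainmentLightFrameOfPrint_of (h : Stmt.stub_cglsHeegnerKolyvaginSystem) :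
    Summit.BirchSwinnertonDyer.BirchSwinnertonDyer.Theses.PrintX9.HowardContainmentLightFrameOfPrint := by
  unfold Stmt.stub_cglsHeegnerKolyvaginSystem at h
  exact Summit.BirchSwinnertonDyer.BirchSwinnertonDyer.Theorems.PrintX9OfKolyvaginSystemLeaf.howardContainmentLightFrameOfPrint_of_kolyvaginSystemLeaf h

/-- The composed line from the stub (sorries only through `stub_*`). -/
theorem HowardContainmentLightFrameOfPrint_of_stubs :
    Summit.BirchSwinnertonDyer.BirchSwinnertonDyer.Theses.PrintX9.HowardContainmentLightFrameOfPrint :=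
  HowardContainmentLightFrameOfPrint_of stub_cglsHeegnerKolyvaginSystem

end Summit.BirchSwinnertonDyer.BirchSwinnertonDyer.Cruxes.HowardContainmentLightFrameOfPrint.TorsionDepthLight
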